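import Summits.Ventures.PercRepro.HyperplaneKeyFive

/-!
# PercRepro — `e`-FREENESS PASSES TO DELETIONS, AND THE KEY ON THE COLOOP-FREE CORE (p1, gen 42; S2 feeder)

Deleting any set from an `e`-free matroid leaves an `e`-free matroid (`free_delete`: the partition at `e` restricted to the
smaller ground set, `delete_closure_eq`), so the hyperplane key applies to the coloop-free core `M ＼ M.coloops` of p2's ladder:
`rls_core_of_hyperplane_key_five` — the level-5 key for the core at the rows `8 … 12`, in the `κ·#U ≤ #Y` shape the coloop ladder
consumes (`S2LP.phi_mul_topCount_le_of_delete_coloops`). Nothing about any cell is claimed here.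

* `free_delete` — `e`-freeness of `M ＼ D`;
* `phi_mul_topCount_le_midCount_of_key_eight` … `_twelve` — `Φ(p,5)·#U ≤ #Y` for an `e`-free matroid of rank `p` on `≥ n₀(p)` points.
Axioms: standard.
-/

open scoped Matroid

namespace PercRepro

namespace HypKey

open Set

variable {α : Type}

/-- **`e`-freeness passes to deletions.** -/
theorem free_delete (M : Matroid α) [M.Finite]
    (hfree : ∀ e ∈ M.E, ∃ A ⊆ M.E \ {e}, e ∉ M.closure A ∧ e ∉ M.closure ((M.E \ {e}) \ A)) (D : Set α) :
    ∀ e ∈ (M ＼ D).E, ∃ A ⊆ (M ＼ D).E \ {e}, e ∉ (M ＼ D).closure A ∧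
      e ∉ (M ＼ D).closure (((M ＼ D).E \ {e}) \ A) := by
  intro e he
  rw [Matroid.delete_ground] at he
  obtain ⟨A, hA, heA, heB⟩ := hfree e he.1
  refine ⟨A \ D, ?_, ?_, ?_⟩
  · rw [Matroid.delete_ground]
    intro x hx
    exact ⟨⟨(hA hx.1).1, hx.2⟩, (hA hx.1).2⟩
  · rw [Matroid.delete_closure_eq]
    rintro ⟨hcl, -⟩
    exact heA (M.closure_subset_closure (sdiff_subset.trans sdiff_subset) hcl)
  · rw [Matroid.delete_closure_eq, Matroid.delete_ground]
    rintro ⟨hcl, -⟩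
    apply heB
    refine M.closure_subset_closure ?_ hcl
    intro x hx
    -- x ∈ (((E \ D) \ {e}) \ (A \ D)) \ D  ⇒  x ∈ (E \ {e}) \ A
    have hxE : x ∈ M.E := hx.1.1.1.1
    have hxe : x ∉ ({e} : Set α) := hx.1.1.2
    have hxD : x ∉ D := hx.2
    have hxA : x ∉ A := fun h => hx.1.2 ⟨h, hxD⟩
    exact ⟨⟨hxE, hxe⟩, hxA⟩

/-- The level-5 key for the row `8` in the ladder's shape: `Φ(8,5)·#U ≤ #Y` on any `e`-free matroid of rank `8` on `≥ 82` points. -/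
theorem phi_mul_topCount_le_midCount_of_key_eight (M : Matroid α) [M.Finite] (hR : M.eRank = ((8 : ℕ) : ℕ∞))
    (hn : 82 ≤ M.E.ncard)
    (hfree : ∀ e ∈ M.E, ∃ A ⊆ M.E \ {e}, e ∉ M.closure A ∧ e ∉ M.closure ((M.E \ {e}) \ A)) :
    (8 / 3 : ℚ) * (Matroid.topCount M 8 5 : ℚ) ≤ (Matroid.midCount M 8 5 : ℚ) := by
  have h := c025_core_five_hyperplane_key_eight M hR hn hfree
  rwa [ThmN.RLS_iff, S2LP.phiK_eight_five] at h

/-- The row `9` (`n ≥ 84`). -/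
theorem phi_mul_topCount_le_midCount_of_key_nine (M : Matroid α) [M.Finite] (hR : M.eRank = ((9 : ℕ) : ℕ∞))
    (hn : 84 ≤ M.E.ncard)
    (hfree : ∀ e ∈ M.E, ∃ A ⊆ M.E \ {e}, e ∉ M.closure A ∧ e ∉ M.closure ((M.E \ {e}) \ A)) :
    (33 / 7 : ℚ) * (Matroid.topCount M 9 5 : ℚ) ≤ (Matroid.midCount M 9 5 : ℚ) := by
  have h := c025_core_five_hyperplane_key_nine M hR hn hfree
  rwa [ThmN.RLS_iff, S2LP.phiK_nine_five] at h

/-- The row `10` (`n ≥ 86`). -/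
theorem phi_mul_topCount_le_midCount_of_key_ten (M : Matroid α) [M.Finite] (hR : M.eRank = ((10 : ℕ) : ℕ∞))
    (hn : 86 ≤ M.E.ncard)
    (hfree : ∀ e ∈ M.E, ∃ A ⊆ M.E \ {e}, e ∉ M.closure A ∧ e ∉ M.closure ((M.E \ {e}) \ A)) :
    (160 / 21 : ℚ) * (Matroid.topCount M 10 5 : ℚ) ≤ (Matroid.midCount M 10 5 : ℚ) := by
  have h := c025_core_five_hyperplane_key_ten M hR hn hfree
  rwa [ThmN.RLS_iff, S2LP.phiK_ten_five] at h

/-- The row `11` (`n ≥ 86`). -/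
theorem phi_mul_topCount_le_midCount_of_key_eleven (M : Matroid α) [M.Finite] (hR : M.eRank = ((11 : ℕ) : ℕ∞))
    (hn : 86 ≤ M.E.ncard)
    (hfree : ∀ e ∈ M.E, ∃ A ⊆ M.E \ {e}, e ∉ M.closure A ∧ e ∉ M.closure ((M.E \ {e}) \ A)) :
    (1991 / 168 : ℚ) * (Matroid.topCount M 11 5 : ℚ) ≤ (Matroid.midCount M 11 5 : ℚ) := by
  have h := c025_core_five_hyperplane_key_eleven M hR hn hfree
  rwa [ThmN.RLS_iff, S2LP.phiK_eleven_five] at h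

/-- The row `12` (`n ≥ 88`). -/
theorem phi_mul_topCount_le_midCount_of_key_twelve (M : Matroid α) [M.Finite] (hR : M.eRank = ((12 : ℕ) : ℕ∞))
    (hn : 88 ≤ M.E.ncard)
    (hfree : ∀ e ∈ M.E, ∃ A ⊆ M.E \ {e}, e ∉ M.closure A ∧ e ∉ M.closure ((M.E \ {e}) \ A)) :
    (127 / 7 : ℚ) * (Matroid.topCount M 12 5 : ℚ) ≤ (Matroid.midCount M 12 5 : ℚ) := by
  have h := c025_core_five_hyperplane_key_twelve M hR hn hfree
  rwa [ThmN.RLS_iff, S2LP.phiK_twelve_five] at h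

end HypKey

end PercRepro
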